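import Summits.BirchSwinnertonDyer.Rank1Residual.GaloisImage.KolyvaginSystemOfEulerSystemPropagated
import Summits.BirchSwinnertonDyer.Rank1Residual.GaloisImage.KolyvaginDerivativeCoefficientChange
import Summits.BirchSwinnertonDyer.Rank1Residual.GaloisImage.PropagatedConditionTopOfNoTorsionThree
import Literature.NumberTheory.EllipticCurves.BSDConductorProofs
import HarnessLib

/-!
# THEOREM D for `𝓕_can` on `E[3^{k+1}]` — the two N11 row classes at the place `3`:
# (a) `E(ℚ₃)[3] = 0` (D7 / `t = 0`: F11/F12 pay the place `3`), (b) ADDITIVE at `3` with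
# `E(ℚ₃)[3] ≠ 0` allowed (the DEEPER derivative family pays: T-DER-BP, n1011-p13); the bad `w ≠ 3`
# by `E(ℚ_w)[3] = 0` in both
# (cell `b2b-bsdres`, n1011 p11 GEN 10; row T-DER, THEOREM D file D5b)

HONEST FRAMING (cell `b2b-bsdres`, run/shared/lean/b2b/bsd-rank1-residual/, verbatim in every
file): the goal of the cell is to DELETE the COMBINATION-SHAPED residual classes of the
Birch–Swinnerton-Dyer formula for ALL analytic-rank `≤ 1` elliptic curves over `ℚ` — "full BSD
formula for every rank `≤ 1` curve in class `C`" assembled STRICTLY from published theorems — so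
that the rank-`≤ 1` remainder becomes exactly the CONSTRUCTION-SHAPED classes, which are TYPED
(missing-input `Prop`s), NOT attempted. This is not "finishing BSD". Team n1011: research route on
the CONSTRUCTION-SHAPED class X4 / §I N11 (route-1 PORT, (P-DER), clause C1/C0); TOOL theorem.
HONEST LIMITS: NO Euler system is asserted to exist (hypothesis `hc`; the PORT binds Kato's by the
§48.4 socket); clause C1 is met with `κ′ = κ`; the value clauses C2/C3 are NOT here; the row-class
certificate `hbad` (`E(ℚ_w)[3] = 0` at every bad `w ≠ 3`) is DISPLAYED; the place `3` costs the
DEPTH DATUM (ROUTE-1 §47 D-N₀, N₀ = 2): the Kolyvagin primes of the datum are of level `m + 1` with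
`k + 2 ≤ m`, and a SECOND coefficient system at depth `m` is displayed.  No definition, no named
fact, no `sorry`.

## What

(a) **`exists_isKolyvaginSystem_propagatedSelmerStructure_three_of_torsion_eq_zero`**: D4
`exists_isKolyvaginSystem_propagatedSelmerStructure` at `p = 3` with `htop : 𝓕_can,3 = ⊤` DISCHARGED
by F11/F12 `propagatedSelmerStructure_three_eq_top_of_torsion_eq_zero` from `E(ℚ₃)[3] = 0` (`htors₃`)
and the family of reduction maps `E[3^{j+1}·3] → E[3^j·3]`, `x ↦ 3x` (`rd`, `hrd`, F12's binders).

(b) **`exists_isKolyvaginSystem_propagatedSelmerStructure_three_of_hasAdditiveReductionAt`**: as D4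
`exists_isKolyvaginSystem_propagatedSelmerStructure` at `p = 3`, depth `k`, with the certificate
`htop : 𝓕_can,3 = ⊤` REPLACED by additive reduction at `3` (`hadd`) plus a second, deeper coefficient
system `(T″, red″, e″)` for `E[3^m·3]`, `k + 2 ≤ m`, both systems reading the reductions of `T_3E`
(`hcomp′ : e′ ∘ red′ = a ↦ a_{k+1}`, `hcomp″ : e″ ∘ red″ = a ↦ a_{m+1}`), the reduction map
`r : E[3^m·3] → E[3^k·3]`, `x ↦ 3^{m−k} x` (`hr`; T-DER-BP's binder), and `𝒫 ⊆` Kolyvagin primes of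
level `m + 1`.  At the place `3` the clause `loc₃ (κ d) ∈ 𝓕_can,k(3)` is n1011-p13's T-DER-BP FILE 4
`CoeffChange.EC.localization_mem_propagatedSelmerStructure_three_of_res_eq_deriv_of_hasAdditiveReductionAt`
applied to the depth-`m` family (D2 at `n = m + 1`, same generators `σ`) and THE depth-`k` class
(D2's uniqueness).  Conclusion: generators `σ`, transports, ONE family `κ` with
`D.IsKolyvaginSystem (propagatedSelmerStructure W 3 k) κ` and the derivative characterisation.
References: B. Mazur, K. Rubin, Mem. AMS 799 (2004), App. A Prop. A.2 (the depth), Thm. 3.2.4;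
K. Rubin, *Euler Systems* (2000), §4.4–4.5; ROUTE-1 §47 (D-N₀).
-/

noncomputable section

open CategoryTheory Function Finset Polynomial Field IsDedekindDomain
open scoped NumberField Classical ContRepresentation
open Literature.NumberTheory.GaloisRepresentations Literature.NumberTheory.EllipticCurves
open Literature.NumberTheory.GaloisRepresentations.DiscreteGaloisModule
open Literature.NumberTheory.GaloisCohomology
open Summit.BirchSwinnertonDyer.Rank1Residual.GaloisImage.CoeffTransport
open Summit.BirchSwinnertonDyer.Rank1Residual.GaloisImage.CyclotomicLevel
open Rat.HeightOneSpectrum WeierstrassCurve TateModule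

universe u

namespace Summit.BirchSwinnertonDyer.Rank1Residual.GaloisImage.Derivative.Rat

variable (W : WeierstrassCurve ℚ) [W.IsElliptic] [W.IsGloballyMinimal]
variable [Module.Free ℤ_[3] (W.tateModule 3)] [Module.Finite ℤ_[3] (W.tateModule 3)]
  [ContinuousSMul ℤ_[3] (W.tateModule 3)]

/-- Local notation: `T∞ = T_3 E` as a continuous `G_ℚ`-representation. -/
local notation3 "T∞" => WeierstrassCurve.tateGaloisRep W 3 (W.continuous_galoisRepTate_holds 3)

/-- Local notation: `𝐫⟦f, T′, U⟧ = f_* : H¹(U, T_3E) → H¹(U, T′)`. -/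
local notation3 (prettyPrint := false) "𝐫⟦" f ", " Tg ", " U "⟧" =>
  ContinuousCohomology.map (ContinuousMonoidHom.id _)
    (X := subgroupRep (ContinuousRep.toTopRep T∞) U)
    (Y := subgroupRep (ContinuousRep.toTopRep Tg) U)
    ((TopRep.resFunctor (Subgroup.subtype U)).map f) 1

variable (S : Set (HeightOneSpectrum (𝓞 ℚ)))

/-- Local notation: `𝓛` = the cyclotomic Euler-system levels `ℚ(μ_{3^{n+1}}, μ_r)`, `r ∩ S = ∅`. -/
local notation3 "𝓛" => cyclotomicLevelsRat 3 S

/-- Local notation: `𝐃⟦A, X, U, τ⟧ ℓ = ∑_{j < ℓ−1} j·(τ_ℓ)_*^j`, Kolyvagin's derivative operator of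
the place `ℓ` on `H¹(U, X)` (`A`-linear) for the generator `τ_ℓ`. -/
local notation3 (prettyPrint := false) "𝐃⟦" A ", " X ", " U ", " τ "⟧" =>
  fun ℓ : HeightOneSpectrum (𝓞 ℚ) =>
  ∑ j ∈ Finset.range (((primesEquiv ℓ : Nat.Primes) : ℕ) - 1),
    (j : Module.End A (continuousCohomology 1 (subgroupRep X U))) *
      (conjMap X U ((τ : HeightOneSpectrum (𝓞 ℚ) → absoluteGaloisGroup ℚ) ℓ) 1).hom.toLinearMap ^ j

omit [W.IsElliptic] [W.IsGloballyMinimal] [Module.Free ℤ_[3] (W.tateModule 3)]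
  [Module.Finite ℤ_[3] (W.tateModule 3)] in
/-- **The merged transport `Φ_U ∘ red_* : H¹(U, T_3E) → H¹(U, E[3^j])` is computed on cocycles by
`a ↦ a_j`** (the shape of T-DER-BP FILE 4's binders `hΨm`/`hΨk`), when `e ∘ red = (a ↦ a_j)`
(`hcomp`, GZ-4's binder). [folklore] -/
theorem comp_map_red_oneCocycleClass {M' : Type} [AddCommGroup M'] [Module ℤ_[3] M']
    [TopologicalSpace M'] [IsTopologicalAddGroup M'] [ContinuousSMul ℤ_[3] M']
    {T' : GaloisRep ℚ ℤ_[3] M'} (red : T∞.toTopRep ⟶ T'.toTopRep) {j : ℕ} {M : ℤ}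
    (e : M' →+ WeierstrassCurve.geomTorsion W M)
    (hcomp : ∀ a : W.tateModule 3, ((e (red.hom a) : geomTorsion W M) : geomPoints W) = proj 3 j a)
    (U : Subgroup (absoluteGaloisGroup ℚ))
    (Φ : continuousCohomology 1 (subgroupRep T'.toTopRep U) →+
      continuousCohomology 1 (subgroupRep (W.torsionGaloisModule M).toTopRep U))
    (hΦ : ∀ (φ : contOneCocycles (subgroupRep T'.toTopRep U))
      (ψ : contOneCocycles (subgroupRep (W.torsionGaloisModule M).toTopRep U)),
      (∀ g, ψ.1 g = e (φ.1 g)) → Φ (oneCocycleClass _ φ) = oneCocycleClass _ ψ)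
    (φ : contOneCocycles (subgroupRep T∞.toTopRep U))
    (ψ : contOneCocycles (subgroupRep (W.torsionGaloisModule M).toTopRep U))
    (hψ : ∀ g, ((ψ.1 g : geomTorsion W M) : geomPoints W) = proj 3 j (φ.1 g)) :
    Φ (𝐫⟦red, T', U⟧ (oneCocycleClass _ φ)) = oneCocycleClass _ ψ := by
  rw [red_oneCocycleClass red U φ]
  refine hΦ _ ψ fun g => Subtype.ext ?_
  rw [hψ g]
  exact (hcomp (φ.1 g)).symm

/-- **THEOREM D for `𝓕_can` on `E[3^k·3]` on the rows with `E(ℚ₃)[3] = 0`** (D7 / `t = 0`; any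
reduction type at `3`): D4 with `htop` discharged by F11/F12 ([MR04] Lemma A.1 at `p = 3`, all
levels).  Binders: D4's at `p = 3` with `htors₃` and the reduction maps `rd`/`hrd` in place of `htop`.
[cite: MazurRubin2004, App. A, Lemma A.1 (p. 79) and Thm. 3.2.4] [cite: Sakamoto2024, Def. 4.1 (p. 926)] -/
theorem exists_isKolyvaginSystem_propagatedSelmerStructure_three_of_torsion_eq_zero
    {c : ∀ (i : ℕ) (r : (𝓛).Ideals), H1 T∞ ((𝓛).level i r.1)}
    (hc : IsEulerSystem 𝓛 T∞ 3 c) {k : ℕ}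
    {M' : Type} [AddCommGroup M'] [Module ℤ_[3] M'] [TopologicalSpace M'] [DiscreteTopology M']
    [IsTopologicalAddGroup M'] [ContinuousSMul ℤ_[3] M'] {T' : GaloisRep ℚ ℤ_[3] M'}
    (red : T∞.toTopRep ⟶ T'.toTopRep) (hred : Function.Surjective red.hom)
    (hM : ∀ x : M', (((3 : ℕ) : ℤ_[3]) ^ (k + 1)) • x = 0)
    (e : M' →+ WeierstrassCurve.geomTorsion W (((3 : ℕ) : ℤ) ^ k * ((3 : ℕ) : ℤ))) (hec : Continuous e)
    (he : ∀ (g : absoluteGaloisGroup ℚ) (x : M'),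
      e (T'.toTopRep.ρ g x) =
        (W.torsionGaloisModule (((3 : ℕ) : ℤ) ^ k * ((3 : ℕ) : ℤ))).toTopRep.ρ g (e x))
    (einv : WeierstrassCurve.geomTorsion W (((3 : ℕ) : ℤ) ^ k * ((3 : ℕ) : ℤ)) →+ M')
    (hic : Continuous einv) (h₁ : ∀ x, einv (e x) = x) (h₂ : ∀ y, e (einv y) = y)
    (hirr : W.HasIrreducibleModPGaloisRep 3)
    (D : KolyvaginDatum (W.torsionGaloisModule (((3 : ℕ) : ℤ) ^ k * ((3 : ℕ) : ℤ))))
    (hT : D.transverse = cyclotomicTransverse (W.torsionGaloisModule (((3 : ℕ) : ℤ) ^ k * ((3 : ℕ) : ℤ))))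
    {η : (ℓ : HeightOneSpectrum (𝓞 ℚ)) → (ZMod (Ideal.absNorm ℓ.asIdeal))ˣ}
    (hD : D.HasCanonicalComparison (3 ^ (k + 1)) η)
    (hPr : D.primes ⊆ (𝓛).primes)
    (hKol : ∀ ℓ ∈ D.primes, Kato.IsKolyvaginPrime W 3 (k + 1) ((primesEquiv ℓ : Nat.Primes) : ℕ))
    (hbad : ∀ w : HeightOneSpectrum (𝓞 ℚ), ¬ W.HasGoodReductionAt w →
      ((primesEquiv w : Nat.Primes) : ℕ) ≠ 3 →
        ∀ P : (W.baseChange (w.adicCompletion ℚ)).toAffine.Point, 3 • P = 0 → P = 0)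
    (htors₃ : ∀ v : HeightOneSpectrum (𝓞 ℚ), ((3 : ℕ) : 𝓞 ℚ) ∈ v.asIdeal →
      ∀ P : (W.baseChange (v.adicCompletion ℚ)).toAffine.Point, 3 • P = 0 → P = 0)
    (rd : ∀ j : ℕ, (W.torsionGaloisModule (((3 : ℕ) : ℤ) ^ (j + 1) * ((3 : ℕ) : ℤ))).toContRepresentation →ⁱL
      (W.torsionGaloisModule (((3 : ℕ) : ℤ) ^ j * ((3 : ℕ) : ℤ))).toContRepresentation)
    (hrd : ∀ (j : ℕ) (x : geomTorsion W (((3 : ℕ) : ℤ) ^ (j + 1) * ((3 : ℕ) : ℤ))),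
      ((rd j x : geomTorsion W (((3 : ℕ) : ℤ) ^ j * ((3 : ℕ) : ℤ))) : geomPoints W) =
        ((3 : ℕ) : ℤ) • (x : geomPoints W)) :
    ∃ (σ : HeightOneSpectrum (𝓞 ℚ) → absoluteGaloisGroup ℚ)
      (Φ : ∀ r : Finset (HeightOneSpectrum (𝓞 ℚ)),
        continuousCohomology 1 (subgroupRep T'.toTopRep ((𝓛).level ⊥ r)) →+
          continuousCohomology 1 (subgroupRep
            (W.torsionGaloisModule (((3 : ℕ) : ℤ) ^ k * ((3 : ℕ) : ℤ))).toTopRep ((𝓛).level ⊥ r)))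
      (comm : ∀ r : Finset (HeightOneSpectrum (𝓞 ℚ)),
        ((r : Finset _) : Set (HeightOneSpectrum (𝓞 ℚ))).Pairwise fun a b =>
          Commute (𝐃⟦ℤ, (W.torsionGaloisModule (((3 : ℕ) : ℤ) ^ k * ((3 : ℕ) : ℤ))).toTopRep,
              ((𝓛).level ⊥ r), σ⟧ a)
            (𝐃⟦ℤ, (W.torsionGaloisModule (((3 : ℕ) : ℤ) ^ k * ((3 : ℕ) : ℤ))).toTopRep,
              ((𝓛).level ⊥ r), σ⟧ b))
      (κ : Finset (HeightOneSpectrum (𝓞 ℚ)) →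
        galoisCohomology (W.torsionGaloisModule (((3 : ℕ) : ℤ) ^ k * ((3 : ℕ) : ℤ))) 1),
      (∀ ℓ, σ ℓ ∈ (adicCompletionPrime ℚ ℓ).inertia (absoluteGaloisGroup ℚ)) ∧
      (∀ ℓ, modNCyclotomicCharacter ℚ (Ideal.absNorm ℓ.asIdeal) (σ ℓ) = η ℓ) ∧
      (∀ r, ∀ (φ : contOneCocycles (subgroupRep T'.toTopRep ((𝓛).level ⊥ r)))
        (ψ : contOneCocycles (subgroupRep
          (W.torsionGaloisModule (((3 : ℕ) : ℤ) ^ k * ((3 : ℕ) : ℤ))).toTopRep ((𝓛).level ⊥ r))),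
        (∀ g, ψ.1 g = e (φ.1 g)) → Φ r (oneCocycleClass _ φ) = oneCocycleClass _ ψ) ∧
      D.IsKolyvaginSystem (propagatedSelmerStructure W 3 k) κ ∧
      (∀ r : Finset (HeightOneSpectrum (𝓞 ℚ)), ¬ (↑r : Set _) ⊆ D.primes → κ r = 0) ∧
      ∀ (r : Finset (HeightOneSpectrum (𝓞 ℚ))) (hr : (↑r : Set _) ⊆ D.primes),
        resSubgroup (W.torsionGaloisModule (((3 : ℕ) : ℤ) ^ k * ((3 : ℕ) : ℤ))).toTopRep
            ((𝓛).level ⊥ r) 1 (κ r) =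
          (r.noncommProd 𝐃⟦ℤ, (W.torsionGaloisModule (((3 : ℕ) : ℤ) ^ k * ((3 : ℕ) : ℤ))).toTopRep,
              ((𝓛).level ⊥ r), σ⟧ (comm r))
            (Φ r (𝐫⟦red, T', ((𝓛).level ⊥ r)⟧
              (c ⊥ ⟨r, fun _ hq => hPr (hr (Finset.mem_coe.2 hq))⟩))) :=
  exists_isKolyvaginSystem_propagatedSelmerStructure W 3 S (by norm_num) hc red hred hM e hec he einv hic
    h₁ h₂ hirr D hT hD hPr hKol hbad fun w hw3 => by
      have hv : ((3 : ℕ) : 𝓞 ℚ) ∈ w.asIdeal :=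
        (Literature.NumberTheory.EllipticCurves.natCast_mem_asIdeal_iff_eq_primesEquiv_symm w
          Nat.prime_three).mpr
          (primesEquiv.injective (by rw [Equiv.apply_symm_apply]; exact Subtype.ext hw3))
      exact propagatedSelmerStructure_three_eq_top_of_torsion_eq_zero W w hv (htors₃ w hv) rd hrd k

/-- **THEOREM D for `𝓕_can` on `E[3^k·3]` on the ADDITIVE rows at `3`** (the place `3` paid by the
deeper family, the bad `w ≠ 3` by `E(ℚ_w)[3] = 0`): see the module docstring for every binder.
[cite: MazurRubin2004, App. A Prop. A.2 and Thm. 3.2.4] [cite: Rubin2000, Def. 4.4.10 and Thm. 4.5.4]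
[cite: Sakamoto2024, Def. 4.1 (p. 926)] -/
theorem exists_isKolyvaginSystem_propagatedSelmerStructure_three_of_hasAdditiveReductionAt
    {c : ∀ (i : ℕ) (r : (𝓛).Ideals), H1 T∞ ((𝓛).level i r.1)}
    (hc : IsEulerSystem 𝓛 T∞ 3 c)
    {k m : ℕ} (hkm : k + 2 ≤ m)
    -- the depth-`k` coefficient system
    {M' : Type} [AddCommGroup M'] [Module ℤ_[3] M'] [TopologicalSpace M'] [DiscreteTopology M']
    [IsTopologicalAddGroup M'] [ContinuousSMul ℤ_[3] M'] {T' : GaloisRep ℚ ℤ_[3] M'}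
    (red : T∞.toTopRep ⟶ T'.toTopRep) (hred : Function.Surjective red.hom)
    (hM : ∀ x : M', (((3 : ℕ) : ℤ_[3]) ^ (k + 1)) • x = 0)
    (e : M' →+ WeierstrassCurve.geomTorsion W (((3 : ℕ) : ℤ) ^ k * ((3 : ℕ) : ℤ))) (hec : Continuous e)
    (he : ∀ (g : absoluteGaloisGroup ℚ) (x : M'),
      e (T'.toTopRep.ρ g x) = (W.torsionGaloisModule (((3 : ℕ) : ℤ) ^ k * ((3 : ℕ) : ℤ))).toTopRep.ρ g (e x))
    (einv : WeierstrassCurve.geomTorsion W (((3 : ℕ) : ℤ) ^ k * ((3 : ℕ) : ℤ)) →+ M') (hic : Continuous einv)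
    (h₁ : ∀ x, einv (e x) = x) (h₂ : ∀ y, e (einv y) = y)
    (hcomp : ∀ a : W.tateModule 3,
      ((e (red.hom a) : geomTorsion W (((3 : ℕ) : ℤ) ^ k * ((3 : ℕ) : ℤ))) : geomPoints W) = proj 3 (k + 1) a)
    -- the depth-`m` coefficient system
    {M'' : Type} [AddCommGroup M''] [Module ℤ_[3] M''] [TopologicalSpace M'']
    [IsTopologicalAddGroup M''] [ContinuousSMul ℤ_[3] M''] {T'' : GaloisRep ℚ ℤ_[3] M''}
    (red'' : T∞.toTopRep ⟶ T''.toTopRep) (hM'' : ∀ x : M'', (((3 : ℕ) : ℤ_[3]) ^ (m + 1)) • x = 0)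
    (e'' : M'' →+ WeierstrassCurve.geomTorsion W (((3 : ℕ) : ℤ) ^ m * ((3 : ℕ) : ℤ))) (hec'' : Continuous e'')
    (he'' : ∀ (g : absoluteGaloisGroup ℚ) (x : M''),
      e'' (T''.toTopRep.ρ g x) = (W.torsionGaloisModule (((3 : ℕ) : ℤ) ^ m * ((3 : ℕ) : ℤ))).toTopRep.ρ g (e'' x))
    (einv'' : WeierstrassCurve.geomTorsion W (((3 : ℕ) : ℤ) ^ m * ((3 : ℕ) : ℤ)) →+ M'') (hic'' : Continuous einv'')
    (h₁'' : ∀ x, einv'' (e'' x) = x) (h₂'' : ∀ y, e'' (einv'' y) = y)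
    (hcomp'' : ∀ a : W.tateModule 3,
      ((e'' (red''.hom a) : geomTorsion W (((3 : ℕ) : ℤ) ^ m * ((3 : ℕ) : ℤ))) : geomPoints W) = proj 3 (m + 1) a)
    -- the reduction `E[3^m·3] → E[3^k·3]`, `x ↦ 3^{m-k} x`
    (r : (W.torsionGaloisModule (((3 : ℕ) : ℤ) ^ m * ((3 : ℕ) : ℤ))).toContRepresentation →ⁱL
      (W.torsionGaloisModule (((3 : ℕ) : ℤ) ^ k * ((3 : ℕ) : ℤ))).toContRepresentation)
    (hr : ∀ x : geomTorsion W (((3 : ℕ) : ℤ) ^ m * ((3 : ℕ) : ℤ)),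
      ((r x : geomTorsion W (((3 : ℕ) : ℤ) ^ k * ((3 : ℕ) : ℤ))) : geomPoints W) =
        (((3 : ℕ) : ℤ) ^ (m - k)) • (x : geomPoints W))
    -- the curve and the datum
    (hirr : W.HasIrreducibleModPGaloisRep 3)
    (hadd : ∀ v : HeightOneSpectrum (𝓞 ℚ), ((primesEquiv v : Nat.Primes) : ℕ) = 3 →
      W.HasAdditiveReductionAt v)
    (D : KolyvaginDatum (W.torsionGaloisModule (((3 : ℕ) : ℤ) ^ k * ((3 : ℕ) : ℤ))))
    (hT : D.transverse = cyclotomicTransverse (W.torsionGaloisModule (((3 : ℕ) : ℤ) ^ k * ((3 : ℕ) : ℤ))))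
    {η : (ℓ : HeightOneSpectrum (𝓞 ℚ)) → (ZMod (Ideal.absNorm ℓ.asIdeal))ˣ}
    (hD : D.HasCanonicalComparison (3 ^ (k + 1)) η)
    (hPr : D.primes ⊆ (𝓛).primes)
    (hKol : ∀ ℓ ∈ D.primes, Kato.IsKolyvaginPrime W 3 (m + 1) ((primesEquiv ℓ : Nat.Primes) : ℕ))
    (hbad : ∀ w : HeightOneSpectrum (𝓞 ℚ), ¬ W.HasGoodReductionAt w →
      ((primesEquiv w : Nat.Primes) : ℕ) ≠ 3 →
        ∀ P : (W.baseChange (w.adicCompletion ℚ)).toAffine.Point, 3 • P = 0 → P = 0) :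
    ∃ (σ : HeightOneSpectrum (𝓞 ℚ) → absoluteGaloisGroup ℚ)
      (Φ : ∀ r : Finset (HeightOneSpectrum (𝓞 ℚ)),
        continuousCohomology 1 (subgroupRep T'.toTopRep ((𝓛).level ⊥ r)) →+
          continuousCohomology 1 (subgroupRep
            (W.torsionGaloisModule (((3 : ℕ) : ℤ) ^ k * ((3 : ℕ) : ℤ))).toTopRep ((𝓛).level ⊥ r)))
      (comm : ∀ r : Finset (HeightOneSpectrum (𝓞 ℚ)),
        ((r : Finset _) : Set (HeightOneSpectrum (𝓞 ℚ))).Pairwise fun a b =>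
          Commute (𝐃⟦ℤ, (W.torsionGaloisModule (((3 : ℕ) : ℤ) ^ k * ((3 : ℕ) : ℤ))).toTopRep, ((𝓛).level ⊥ r), σ⟧ a)
            (𝐃⟦ℤ, (W.torsionGaloisModule (((3 : ℕ) : ℤ) ^ k * ((3 : ℕ) : ℤ))).toTopRep, ((𝓛).level ⊥ r), σ⟧ b))
      (κ : Finset (HeightOneSpectrum (𝓞 ℚ)) →
        galoisCohomology (W.torsionGaloisModule (((3 : ℕ) : ℤ) ^ k * ((3 : ℕ) : ℤ))) 1),
      (∀ ℓ, σ ℓ ∈ (adicCompletionPrime ℚ ℓ).inertia (absoluteGaloisGroup ℚ)) ∧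
      (∀ ℓ, modNCyclotomicCharacter ℚ (Ideal.absNorm ℓ.asIdeal) (σ ℓ) = η ℓ) ∧
      (∀ r, ∀ (φ : contOneCocycles (subgroupRep T'.toTopRep ((𝓛).level ⊥ r)))
        (ψ : contOneCocycles (subgroupRep
          (W.torsionGaloisModule (((3 : ℕ) : ℤ) ^ k * ((3 : ℕ) : ℤ))).toTopRep ((𝓛).level ⊥ r))),
        (∀ g, ψ.1 g = e (φ.1 g)) → Φ r (oneCocycleClass _ φ) = oneCocycleClass _ ψ) ∧
      D.IsKolyvaginSystem (propagatedSelmerStructure W 3 k) κ ∧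
      (∀ r : Finset (HeightOneSpectrum (𝓞 ℚ)), ¬ (↑r : Set _) ⊆ D.primes → κ r = 0) ∧
      ∀ (r : Finset (HeightOneSpectrum (𝓞 ℚ))) (hr : (↑r : Set _) ⊆ D.primes),
        resSubgroup (W.torsionGaloisModule (((3 : ℕ) : ℤ) ^ k * ((3 : ℕ) : ℤ))).toTopRep ((𝓛).level ⊥ r) 1 (κ r) =
          (r.noncommProd 𝐃⟦ℤ, (W.torsionGaloisModule (((3 : ℕ) : ℤ) ^ k * ((3 : ℕ) : ℤ))).toTopRep,
              ((𝓛).level ⊥ r), σ⟧ (comm r))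
            (Φ r (𝐫⟦red, T', ((𝓛).level ⊥ r)⟧
              (c ⊥ ⟨r, fun _ hq => hPr (hr (Finset.mem_coe.2 hq))⟩))) := by
  have hmk : ((3 : ℕ) : ℤ) ^ k * ((3 : ℕ) : ℤ) = ((3 ^ (k + 1) : ℕ) : ℤ) := by push_cast; ring
  have hmm : ((3 : ℕ) : ℤ) ^ m * ((3 : ℕ) : ℤ) = ((3 ^ (m + 1) : ℕ) : ℤ) := by push_cast; ring
  have hKolk : ∀ ℓ ∈ D.primes, Kato.IsKolyvaginPrime W 3 (k + 1) ((primesEquiv ℓ : Nat.Primes) : ℕ) :=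
    fun ℓ hℓ => (hKol ℓ hℓ).mono (by omega)
  -- the generators (D1)
  obtain ⟨σ, hσI, hσχ, -, hσ⟩ := CyclotomicLevel.Rat.exists_sigma_mem_inertia_adicCompletionPrime 3 S η
    D.primes (fun ℓ hℓ => hD.zpowers_eq_top hℓ)
  -- `h0` at both depths from `Irr(E[3])`
  have h0 : ∀ r : Finset (HeightOneSpectrum (𝓞 ℚ)), (↑r : Set _) ⊆ D.primes →
      ∀ P : WeierstrassCurve.geomTorsion W (((3 : ℕ) : ℤ) ^ k * ((3 : ℕ) : ℤ)),
        (∀ u : (𝓛).level ⊥ r, (u : absoluteGaloisGroup ℚ) • P = P) → P = 0 :=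
    fun r _ P hP => geomTorsion_eq_zero_of_fixed_level W 3 S (by norm_num) hirr hmk ⊥ r P hP
  have h0'' : ∀ r : Finset (HeightOneSpectrum (𝓞 ℚ)), (↑r : Set _) ⊆ D.primes →
      ∀ P : WeierstrassCurve.geomTorsion W (((3 : ℕ) : ℤ) ^ m * ((3 : ℕ) : ℤ)),
        (∀ u : (𝓛).level ⊥ r, (u : absoluteGaloisGroup ℚ) • P = P) → P = 0 :=
    fun r _ P hP => geomTorsion_eq_zero_of_fixed_level W 3 S (by norm_num) hirr hmm ⊥ r P hP
  -- the two families (D2), same generators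
  obtain ⟨Φ, comm, hΦ, κ, hκ0, hκ⟩ := exists_derivativeFamily W 3 S hc red (Nat.succ_pos k) hM e hec he
    einv hic h₁ h₂ D.primes hPr hKolk σ hσ h0
  obtain ⟨Φ'', comm'', hΦ'', κ'', -, hκ''⟩ := exists_derivativeFamily W 3 S hc red'' (Nat.succ_pos m)
    hM'' e'' hec'' he'' einv'' hic'' h₁'' h₂'' D.primes hPr hKol σ hσ h0''
  refine ⟨σ, Φ, comm, κ, hσI, hσχ, hΦ, ?_, hκ0, fun r hr => (hκ r hr).1⟩
  refine isKolyvaginSystem_derivativeFamily_of_transverse_eq W 3 S (by norm_num) hc red hred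
    (Nat.succ_pos k) hM hmk e hec he einv hic h₁ h₂ D hT hD hPr hKolk σ (fun ℓ _ => hσI ℓ)
    (fun ℓ _ => hσχ ℓ) hσ h0 Φ hΦ comm κ hκ0 (fun r hr => (hκ r hr).1) (propagatedSelmerStructure W 3 k)
    (fun w hw hne => (propagatedSelmerStructure_inr_eq_unramifiedSubgroup W 3 k
      (WeierstrassCurve.natCast_not_mem_asIdeal_of_primesEquiv_ne Fact.out hne) hw).ge)
    fun d hd w hwd hw => ?_
  by_cases hw3 : ((primesEquiv w : Nat.Primes) : ℕ) = 3
  · -- the place `3`: T-DER-BP FILE 4 with the deeper family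
    exact CoeffChange.EC.localization_mem_propagatedSelmerStructure_three_of_res_eq_deriv_of_hasAdditiveReductionAt
      W (W.continuous_galoisRepTate_holds 3) hw3 (hadd w hw3) hkm r hr ((𝓛).level ⊥ d) σ
      (fun ℓ => ((primesEquiv ℓ : Nat.Primes) : ℕ) - 1) d (comm'' d) (comm d)
      (c ⊥ ⟨d, fun _ hq => hPr (hd (Finset.mem_coe.2 hq))⟩)
      ((Φ'' d).comp (𝐫⟦red'', T'', ((𝓛).level ⊥ d)⟧).hom.toAddMonoidHom)
      (fun φ ψ hψ => comp_map_red_oneCocycleClass W red'' e'' hcomp'' _ (Φ'' d) (hΦ'' d) φ ψ hψ)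
      ((Φ d).comp (𝐫⟦red, T', ((𝓛).level ⊥ d)⟧).hom.toAddMonoidHom)
      (fun φ ψ hψ => comp_map_red_oneCocycleClass W red e hcomp _ (Φ d) (hΦ d) φ ψ hψ)
      (κ'' d) (hκ'' d hd).1 ⟨κ d, (hκ d hd).1, fun κ₁ h => (hκ d hd).2 κ₁ h⟩ (κ d) (hκ d hd).1
  · -- a bad place `w ≠ 3`: `H¹(ℚ_w, E[3^k·3]) = 0`
    rw [propagatedSelmerStructure_inr_eq_top_of_torsion_eq_zero W 3 k
      (WeierstrassCurve.natCast_not_mem_asIdeal_of_primesEquiv_ne Fact.out hw3)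
      (hbad w (fun hgood => hw ⟨hgood, hw3⟩) hw3)]
    exact AddSubgroup.mem_top _

end Summit.BirchSwinnertonDyer.Rank1Residual.GaloisImage.Derivative.Rat

end
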